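import Summits.CriticalPhenomena.PercolationContinuityZ3.Theorems.Transplant.FKConnectivityAllQAntipodalTwoSpinePBridgeSummand
import Summits.CriticalPhenomena.PercolationContinuityZ3.Theorems.Transplant.FKConnectivityAllQAntipodalTwoSpineBridge
import HarnessLib

/-!
# Two-spine word model of `U¹¹` — the SEMANTIC BRIDGE at a PARALLEL split node, part 2:
# `q^{c} · apUpcSplit(A ∥ B) = q^{4|V|} · dsum_P(root; fiber2)`

Helper file (`--supports stmt-CriticalPhenomena-4575`), FK sub-lane `prim-bschramm-fk-2` (gen 16); builds on p205010 (kernel theorem,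
internal audit signed; external expert review pending).  No named facts, no sorries, standard axioms.

Memo `bschramm/FROM-fk-2-g15-TWO-SPINE.md` §10.11/§12.3 and blueprint `prim-bschramm-fk-2-g15/BLUEPRINT-U11-LEAN.md` L1/L3.  SETTING as in
part 1 (`…TwoSpinePBridgeSummand`): a parallel split node `N = A ∥ B` between `s, t`, `A` grown from the marked edge `y` along `psA`,
`B` from `z` along `psB`, edge-disjoint with vertex spans meeting only in `{s, t}`.
**`apUpcSplit_parallel_bridge`**: for `h` not reading `y, z`,
`q^{2 + 2(1 + |psA| + |psB|)|V|} · apUpcSplit q (A ∪ B) s t y z h = q^{4|V|} · dsum q .P ⟨[((o,o,o,o),0)],[]⟩ (shape psA) (shape psB) fiber2`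
— the split up-correlation functional of a PARALLEL composition is the PARALLEL-top root sum of the two-spine word model against the
two-spine fibre sums (same four-family decomposition of the configurations as in the series case `…TwoSpineBridge`).  With the
parallel-top rule theorem `dstmt_root_P` (`…TwoSpineDualRule`) this yields `U¹¹(A ∥ B) ≥ 0` (`…TwoSpineParallelCore`).
[cite: Grimmett2006, §1.4 eq. (1.20) (p. 15); §3.8 (pp. 61–62); §3.9 (p. 63)]
-/

noncomputable section

namespace Summit.CriticalPhenomena.PercolationContinuityZ3.Theorems

namespace FK

namespace TwoSpine

open SimpleGraph Literature.Probability.LatticeModels Literature.Probability.Percolation X2Word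
open scoped Classical

variable {V : Type*} [Fintype V]

section Bridge

variable {psA psB : List (SpinePart V)} {A B : Finset (Sym2 V)} {V₁ V₂ : Set V} {y₁ y₂ z₁ z₂ s t : V}

omit [Fintype V] in
/-- A configuration avoiding both marked edges does not split them (parallel setting). [folklore] -/
theorem splitInd_inter_none' (hA : IsSpine psA {s(y₁, y₂)} y₁ y₂ A s t) (hB : IsSpine psB {s(z₁, z₂)} z₁ z₂ B s t)
    (hd : Disjoint A B) {X Y : Finset (Sym2 V)} (hX : X ⊆ A.erase s(y₁, y₂)) (hY : Y ⊆ B.erase s(z₁, z₂)) :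
    splitInd s(y₁, y₂) s(z₁, z₂) (X ∪ Y) = 0 := by
  have hyA := marked_mem hA
  have hzB := marked_mem hB
  have hyB : s(y₁, y₂) ∉ B := fun hh => Finset.disjoint_left.1 hd hyA hh
  have hzA : s(z₁, z₂) ∉ A := fun hh => Finset.disjoint_left.1 hd hh hzB
  have hyγ : s(y₁, y₂) ∉ X ∪ Y := by
    rw [Finset.mem_union, not_or]
    exact ⟨fun hh => Finset.notMem_erase _ A (hX hh), fun hh => hyB ((hY.trans (Finset.erase_subset _ _)) hh)⟩
  have hzγ : s(z₁, z₂) ∉ X ∪ Y := by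
    rw [Finset.mem_union, not_or]
    exact ⟨fun hh => hzA ((hX.trans (Finset.erase_subset _ _)) hh), fun hh => Finset.notMem_erase _ B (hY hh)⟩
  unfold splitInd
  rw [if_neg (fun hh => hyγ (hh.2 hzγ))]

omit [Fintype V] in
/-- The root coefficient `Θ_P(u,v)` at a parallel top, unfolded: the two Janus halves with their cluster corrections. [folklore] -/
theorem theta_P_o (q : ℝ) (u v : List SLetter) :
    theta q .P (Mode.o, Mode.o, Mode.o, Mode.o) u v =
      q ^ baseExp (Mode.o, Mode.o, Mode.o, Mode.o) u v *
        (q ^ (2 - Mode.o.del (sRowA u) - Mode.o.del (sRowB v)) *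
            (q ^ (if Mode.o.connDot (sRowA u) * Mode.o.conn (sRowA v) = 1 then 1 else 0 : ℕ) *
              q ^ (if Mode.o.conn (sRowB u) * Mode.o.connDot (sRowB v) = 1 then 1 else 0 : ℕ)) *
            ((Mode.o.connDot (sRowA u) + Mode.o.conn (sRowA v) - Mode.o.connDot (sRowA u) * Mode.o.conn (sRowA v)) -
              (Mode.o.conn (sRowB u) + Mode.o.connDot (sRowB v) - Mode.o.conn (sRowB u) * Mode.o.connDot (sRowB v))) +
          q ^ (2 - Mode.o.del (sRowB u) - Mode.o.del (sRowA v)) *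
            (q ^ (if Mode.o.conn (sRowA u) * Mode.o.connDot (sRowA v) = 1 then 1 else 0 : ℕ) *
              q ^ (if Mode.o.connDot (sRowB u) * Mode.o.conn (sRowB v) = 1 then 1 else 0 : ℕ)) *
            ((Mode.o.conn (sRowA u) + Mode.o.connDot (sRowA v) - Mode.o.conn (sRowA u) * Mode.o.connDot (sRowA v)) -
              (Mode.o.connDot (sRowB u) + Mode.o.conn (sRowB v) - Mode.o.connDot (sRowB u) * Mode.o.conn (sRowB v)))) := rfl

/-- **THE SEMANTIC BRIDGE at a PARALLEL split node**: for `h` not reading the marked edges,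
`q^{2 + 2(1 + |psA| + |psB|)|V|} · apUpcSplit q (A ∪ B) s t y z h = q^{4|V|} · dsum q .P ⟨[((o,o,o,o),0)],[]⟩ (shape A) (shape B) fiber2`.
[cite: Grimmett2006, §1.4 eq. (1.20) (p. 15); §3.8 (pp. 61–62); §3.9 (p. 63)] -/
theorem apUpcSplit_parallel_bridge (q : ℝ) (hA : IsSpine psA {s(y₁, y₂)} y₁ y₂ A s t) (hB : IsSpine psB {s(z₁, z₂)} z₁ z₂ B s t)
    (hy : y₁ ≠ y₂) (hz : z₁ ≠ z₂) (hd : Disjoint A B)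
    (h₁ : ∀ e ∈ (↑A : Set (Sym2 V)), ∀ x ∈ e, x ∈ V₁) (h₂ : ∀ e ∈ (↑B : Set (Sym2 V)), ∀ x ∈ e, x ∈ V₂)
    (hS : V₁ ∩ V₂ ⊆ {s, t}) (hst : s ≠ t)
    {h : Finset (Sym2 V) → ℝ} (hhy : ∀ C, h (insert s(y₁, y₂) C) = h C) (hhz : ∀ C, h (insert s(z₁, z₂) C) = h C) :
    q ^ (2 + 2 * ((1 + psA.length + psB.length) * Fintype.card V)) * apUpcSplit q (A ∪ B) s t s(y₁, y₂) s(z₁, z₂) h =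
      q ^ (4 * Fintype.card V) *
        dsum q .P ⟨[((Mode.o, Mode.o, Mode.o, Mode.o), 0)], []⟩ (psA.map (·.kind)) (psB.map (·.kind))
          (fun _ => fiber2 q psA psB (A.erase s(y₁, y₂)) (B.erase s(z₁, z₂)) h) := by
  set y : Sym2 V := s(y₁, y₂) with hy_def
  set z : Sym2 V := s(z₁, z₂) with hz_def
  set TA := A.erase y with hTA
  set TB := B.erase z with hTB
  set C := 2 + 2 * ((1 + psA.length + psB.length) * Fintype.card V) with hCdef
  have hyA : y ∈ A := marked_mem hA
  have hzB : z ∈ B := marked_mem hB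
  have hAe : A.powerset = (insert y TA).powerset := by rw [Finset.insert_erase hyA]
  have hBe : B.powerset = (insert z TB).powerset := by rw [Finset.insert_erase hzB]
  have hyTA : y ∉ TA := Finset.notMem_erase y A
  have hzTB : z ∉ TB := Finset.notMem_erase z B
  -- the right-hand side as a double sum over configuration pairs
  have hR : dsum q .P ⟨[((Mode.o, Mode.o, Mode.o, Mode.o), 0)], []⟩ (psA.map (·.kind)) (psB.map (·.kind))
        (fun _ => fiber2 q psA psB TA TB h) =
      ∑ X ∈ TA.powerset, ∑ Y ∈ TB.powerset, theta q .P (Mode.o, Mode.o, Mode.o, Mode.o) (spineWord psA TA X) (spineWord psB TB Y) *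
        (q ^ expSum psA TA X * (q ^ expSum psB TB Y * h (X ∪ Y))) := by
    rw [sum_pairs_eq_sum_words]
    simp [dsum]
  rw [hR, Finset.mul_sum]
  -- the left-hand side: split the configurations of `A ∪ B` by the two marked edges
  unfold apUpcSplit
  rw [Finset.mul_sum, sum_powerset_union_disj hd, hAe, Finset.sum_powerset_insert hyTA]
  have inner : ∀ γA : Finset (Sym2 V), ∑ γB ∈ B.powerset, q ^ C * (q ^ apExp (A ∪ B) (γA ∪ γB) *
      (splitInd y z (γA ∪ γB) * ((apConn (γA ∪ γB) s t - apConn ((A ∪ B) \ (γA ∪ γB)) s t) * h (γA ∪ γB)))) =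
      ∑ Y ∈ TB.powerset, q ^ C * (q ^ apExp (A ∪ B) (γA ∪ Y) *
        (splitInd y z (γA ∪ Y) * ((apConn (γA ∪ Y) s t - apConn ((A ∪ B) \ (γA ∪ Y)) s t) * h (γA ∪ Y)))) +
      ∑ Y ∈ TB.powerset, q ^ C * (q ^ apExp (A ∪ B) (γA ∪ insert z Y) *
        (splitInd y z (γA ∪ insert z Y) *
          ((apConn (γA ∪ insert z Y) s t - apConn ((A ∪ B) \ (γA ∪ insert z Y)) s t) * h (γA ∪ insert z Y)))) := by
    intro γA
    rw [hBe, Finset.sum_powerset_insert hzTB]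
  simp_rw [inner]
  rw [Finset.sum_add_distrib, Finset.sum_add_distrib]
  -- the four families: none / z only / y only / both
  have h00 : ∑ X ∈ TA.powerset, ∑ Y ∈ TB.powerset, q ^ C * (q ^ apExp (A ∪ B) (X ∪ Y) *
      (splitInd y z (X ∪ Y) * ((apConn (X ∪ Y) s t - apConn ((A ∪ B) \ (X ∪ Y)) s t) * h (X ∪ Y)))) = 0 := by
    refine Finset.sum_eq_zero fun X hX => Finset.sum_eq_zero fun Y hY => ?_
    rw [splitInd_inter_none' hA hB hd (Finset.mem_powerset.1 hX) (Finset.mem_powerset.1 hY)]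
    ring
  have h11 : ∑ X ∈ TA.powerset, ∑ Y ∈ TB.powerset, q ^ C * (q ^ apExp (A ∪ B) (insert y X ∪ insert z Y) *
      (splitInd y z (insert y X ∪ insert z Y) *
        ((apConn (insert y X ∪ insert z Y) s t - apConn ((A ∪ B) \ (insert y X ∪ insert z Y)) s t) * h (insert y X ∪ insert z Y)))) = 0 := by
    refine Finset.sum_eq_zero fun X _ => Finset.sum_eq_zero fun Y _ => ?_
    rw [splitInd_inter_both]
    ring
  have h01 : ∑ X ∈ TA.powerset, ∑ Y ∈ TB.powerset, q ^ C * (q ^ apExp (A ∪ B) (X ∪ insert z Y) *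
      (splitInd y z (X ∪ insert z Y) *
        ((apConn (X ∪ insert z Y) s t - apConn ((A ∪ B) \ (X ∪ insert z Y)) s t) * h (X ∪ insert z Y)))) =
      ∑ X ∈ TA.powerset, ∑ Y ∈ TB.powerset, q ^ (4 * Fintype.card V) *
        (q ^ baseExp (Mode.o, Mode.o, Mode.o, Mode.o) (spineWord psA TA X) (spineWord psB TB Y) *
          (q ^ (2 - Mode.o.del (sRowB (spineWord psA TA X)) - Mode.o.del (sRowA (spineWord psB TB Y))) *
            (q ^ (if Mode.o.conn (sRowA (spineWord psA TA X)) * Mode.o.connDot (sRowA (spineWord psB TB Y)) = 1 then 1 else 0 : ℕ) *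
              q ^ (if Mode.o.connDot (sRowB (spineWord psA TA X)) * Mode.o.conn (sRowB (spineWord psB TB Y)) = 1 then 1 else 0 : ℕ)) *
            ((Mode.o.conn (sRowA (spineWord psA TA X)) + Mode.o.connDot (sRowA (spineWord psB TB Y)) -
                Mode.o.conn (sRowA (spineWord psA TA X)) * Mode.o.connDot (sRowA (spineWord psB TB Y))) -
              (Mode.o.connDot (sRowB (spineWord psA TA X)) + Mode.o.conn (sRowB (spineWord psB TB Y)) -
                Mode.o.connDot (sRowB (spineWord psA TA X)) * Mode.o.conn (sRowB (spineWord psB TB Y))))) *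
          (q ^ expSum psA TA X * (q ^ expSum psB TB Y * h (X ∪ Y)))) :=
    Finset.sum_congr rfl fun X hX => Finset.sum_congr rfl fun Y hY =>
      psummand_inr q hA hB hy hz hd h₁ h₂ hS hst hhz (Finset.mem_powerset.1 hX) (Finset.mem_powerset.1 hY)
  have h10 : ∑ X ∈ TA.powerset, ∑ Y ∈ TB.powerset, q ^ C * (q ^ apExp (A ∪ B) (insert y X ∪ Y) *
      (splitInd y z (insert y X ∪ Y) *
        ((apConn (insert y X ∪ Y) s t - apConn ((A ∪ B) \ (insert y X ∪ Y)) s t) * h (insert y X ∪ Y)))) =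
      ∑ X ∈ TA.powerset, ∑ Y ∈ TB.powerset, q ^ (4 * Fintype.card V) *
        (q ^ baseExp (Mode.o, Mode.o, Mode.o, Mode.o) (spineWord psA TA X) (spineWord psB TB Y) *
          (q ^ (2 - Mode.o.del (sRowA (spineWord psA TA X)) - Mode.o.del (sRowB (spineWord psB TB Y))) *
            (q ^ (if Mode.o.connDot (sRowA (spineWord psA TA X)) * Mode.o.conn (sRowA (spineWord psB TB Y)) = 1 then 1 else 0 : ℕ) *
              q ^ (if Mode.o.conn (sRowB (spineWord psA TA X)) * Mode.o.connDot (sRowB (spineWord psB TB Y)) = 1 then 1 else 0 : ℕ)) *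
            ((Mode.o.connDot (sRowA (spineWord psA TA X)) + Mode.o.conn (sRowA (spineWord psB TB Y)) -
                Mode.o.connDot (sRowA (spineWord psA TA X)) * Mode.o.conn (sRowA (spineWord psB TB Y))) -
              (Mode.o.conn (sRowB (spineWord psA TA X)) + Mode.o.connDot (sRowB (spineWord psB TB Y)) -
                Mode.o.conn (sRowB (spineWord psA TA X)) * Mode.o.connDot (sRowB (spineWord psB TB Y))))) *
          (q ^ expSum psA TA X * (q ^ expSum psB TB Y * h (X ∪ Y)))) :=
    Finset.sum_congr rfl fun X hX => Finset.sum_congr rfl fun Y hY =>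
      psummand_inl q hA hB hy hz hd h₁ h₂ hS hst hhy (Finset.mem_powerset.1 hX) (Finset.mem_powerset.1 hY)
  rw [h00]
  rw [h11]
  rw [h01]
  rw [h10]
  rw [zero_add, add_zero]
  simp only [← Finset.sum_add_distrib, Finset.mul_sum]
  refine Finset.sum_congr rfl fun X _ => Finset.sum_congr rfl fun Y _ => ?_
  rw [theta_P_o]
  ring

end Bridge

end TwoSpine

end FK

end Summit.CriticalPhenomena.PercolationContinuityZ3.Theorems

end
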